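import Mathlib
import Summits.Langlands.Langlands.Theorems.PhantomRMYoshidaStableYoshidaCongruenceModelFp
import Summits.Langlands.Langlands.Theorems.PhantomRMYoshidaStableYoshidaCongruenceSector
import HarnessLib

/-!
# Route `PhantomRMYoshida`, crux `StableYoshidaCongruence` (stmt-Langlands-13640), line
# `bilevel-one-five-anchor`: Stub 1 `stub_blockModelFp` — the BLOCK-DIAGONAL `𝔽_p`-model of an
# `𝔽_p`-rational pair

`k` algebraically closed of characteristic `p` with the DISCRETE topology, `σ, σ' : Γ_ℚ → GL₂(k)`
continuous and irreducible with `det σ = det σ' = ε̄⁻¹` (LTWS `DetCond`), and EACH constituent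
`𝔽_p`-rational: every `det(X - σ(g))` and every `det(X - σ'(g))` is the image of a polynomial over `𝔽_p`.
Then there are continuous `τ, τ' : Γ_ℚ → GL₂(𝔽_p)` and the block-diagonal `ρb = τ ⊕ τ' : Γ_ℚ → GL₄(𝔽_p)`
(`IsBlockPair`, copied VERBATIM from the checked skeleton
`Cruxes/StableYoshidaCongruence/Lines/bilevel_one_five_anchor.lean`, together with `DetCondFp`) such that
`ρb ⊗ k` is `GL₄(k)`-conjugate to `σ ⊕ σ'` (LTWS `IsModelOf`), `τ`, `τ'` are irreducible over `𝔽_p`, and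
`det τ = det τ' = ε̄⁻¹` (`DetCondFp`): the registered signature `stub_blockModelFp`.

Proof.  This is Case A `ModelFp.exists_model_of_frobenius_fixed` of the landed
`…ModelFpDichotomy.lean` with three more clauses exported: descend `σ`, `σ'` to `ρ₁, ρ₂ : Γ_ℚ → GL₂(𝔽_p)`
with the same characteristic polynomials (Deligne–Serre 1974, Lemme 6.13 for `n = 2`, tree
`exists_descent_fin_two`); they are continuous because their kernels contain the open `ker σ`, `ker σ'`
(`ModelFp.continuous_of_ker_le`); the block sum `ρ₀ = ρ₁ ⊕ ρ₂` (tree `exists_blockDiag_hom`) is continuous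
likewise, and its base change `ψ₁ ⊕ ψ₂` is conjugate to `σ ⊕ σ'` by Brauer–Nesbitt
(`ModelFp.exists_conj_blockDiag`).  Irreducibility of `ρᵢ` over `𝔽_p`: `ψᵢ = ρᵢ ⊗ k` has the characteristic
polynomials of the irreducible `σ` (resp. `σ'`), hence is irreducible (`ModelFp.isIrreducible_of_charpoly_eq`),
and a common eigenvector `v ∈ 𝔽_p²` of the `ρᵢ(g)` would give the common eigenvector `c ∘ v` of the
`ψᵢ(g)` (`isIrreducible_of_isIrreducible_map`).  Determinants: `det M = (-1)ⁿ · det(X - M)(0)`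
(Mathlib `Matrix.det_eq_sign_charpoly_coeff`), so `c(det ρᵢ(g)) = det σ(g) = c(ε̄(g)⁻¹)` and `c : 𝔽_p → k`
is injective.

Everything used is proved in the tree (`…ModelFpDescent`, `…ModelFpDichotomy`, `FiniteFieldDescentAbsIrred`,
`Semisimplification`, the LTWS modules for `DetCond`, `IsModelOf`, `toK`, `epsBar`); no named fact is taken
as a hypothesis.  Worker of lead prover-line-stmt-Langlands-13640-a2-0 (2026-08-16).
-/

-- `Summit.Langlands.Langlands.…` (summit = sub-problem name, D-0017 layout) trips `dupNamespace` on every decl.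
set_option linter.dupNamespace false

noncomputable section

open Polynomial Matrix
open Literature.NumberTheory.GaloisRepresentations
open Literature.RepresentationTheory.Semisimple
open Summit.Langlands.Langlands.Cruxes.StableYoshidaCongruence.LevelThreeWeierstrassSwitch
open Summit.Langlands.Langlands.Cruxes.StableYoshidaCongruence.BurkhardtWeddleTwoThreeAnchor.ModelFp

namespace Summit.Langlands.Langlands.Cruxes.StableYoshidaCongruence.BilevelOneFiveAnchor

/-! ## Vocabulary — `IsBlockPair`, `DetCondFp` (verbatim from the checked skeleton) -/

section Vocabulary

variable (p : ℕ) [Fact p.Prime] (k : Type) [Field k] [CharP k p] [TopologicalSpace k] [DiscreteTopology k]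

variable {p k}

/-- `IsBlockPair τ τ' ρb`: the `GL₄(𝔽_p)`-valued `ρb` IS the block-diagonal sum `τ ⊕ τ'` of two
`GL₂(𝔽_p)`-valued representations (same `reindex ∘ fromBlocks` spelling as the route's `PhantomRMTransport` and
LTWS `IsModelOf`).  In the moduli dictionary: `ρb = (B[5]^*)^{ss}`, `τ = K(λ̂)^*`, `τ' = K(λ)^*`. -/
def IsBlockPair (τ τ' : FramedGaloisRep ℚ (ZMod p) 2) (ρb : FramedGaloisRep ℚ (ZMod p) 4) : Prop :=
  ∀ x, (ρb x).val =
    Matrix.reindex finSumFinEquiv finSumFinEquiv (Matrix.fromBlocks (τ x).val 0 0 (τ' x).val)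

variable (p) in
/-- `DetCondFp τ τ'`: `det τ = det τ' = ε̄⁻¹` over `𝔽_p` (a `(1,p)`-kernel and its quotient both have
`det = ε̄`; their linear duals `det = ε̄⁻¹`). -/
def DetCondFp (τ τ' : FramedGaloisRep ℚ (ZMod p) 2) : Prop :=
  ∀ g, FramedRep.det τ g = (epsBar p g)⁻¹ ∧ FramedRep.det τ' g = (epsBar p g)⁻¹

end Vocabulary

/-! ## Two small lemmas: determinants from characteristic polynomials, descent of irreducibility -/

section Small

/-- A ring homomorphism carrying `det(X - M)` to `det(X - N)` carries `det M` to `det N`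
(`det M = (-1)ⁿ · det(X - M)(0)`, Mathlib `Matrix.det_eq_sign_charpoly_coeff`). [folklore] -/
theorem map_det_of_charpoly_map_eq {R S : Type} [CommRing R] [CommRing S] (f : R →+* S) {n : Type}
    [Fintype n] [DecidableEq n] (M : Matrix n n R) (N : Matrix n n S)
    (h : M.charpoly.map f = N.charpoly) : f M.det = N.det := by
  rw [Matrix.det_eq_sign_charpoly_coeff, Matrix.det_eq_sign_charpoly_coeff, map_mul, map_pow, map_neg,
    map_one, ← Polynomial.coeff_map, h]

/-- **Irreducibility of a plane representation descends along a change of coefficients**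
`f : k → k'` (a homomorphism of fields, injective): a common eigenvector `v ∈ k²` of the `ψ(g)`
(`ModelFp.exists_eigenvector_of_not_isIrreducible`) would give the common eigenvector `f ∘ v` of the
`f(ψ(g))` (`f(M) (f ∘ v) = f ∘ (M v)`, Mathlib `RingHom.map_mulVec`), which an irreducible plane
representation does not have (`ModelFp.exists_mulVec_not_mem_span`). [folklore] -/
theorem isIrreducible_of_isIrreducible_map {k k' : Type} [Field k] [Field k'] {G : Type} [Group G]
    (f : k →+* k') (ψ : G →* GL (Fin 2) k)
    (hψ : Representation.IsIrreducible
      ((glStdRepresentation (Fin 2) k').comp ((Matrix.GeneralLinearGroup.map f).comp ψ))) :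
    Representation.IsIrreducible ((glStdRepresentation (Fin 2) k).comp ψ) := by
  by_contra h
  obtain ⟨v, hv0, hv⟩ := exists_eigenvector_of_not_isIrreducible ψ h
  have hfv0 : (⇑f ∘ v) ≠ 0 := by
    intro hh
    apply hv0
    funext i
    exact (map_eq_zero f).mp (by simpa using congr_fun hh i)
  obtain ⟨g, hg⟩ := exists_mulVec_not_mem_span ((Matrix.GeneralLinearGroup.map f).comp ψ) hψ hfv0
  apply hg
  obtain ⟨a, ha⟩ := Submodule.mem_span_singleton.mp (hv g)
  refine Submodule.mem_span_singleton.mpr ⟨f a, ?_⟩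
  funext i
  calc (f a • (⇑f ∘ v)) i = f ((a • v) i) := by simp [map_mul]
    _ = f ((((ψ g : GL (Fin 2) k) : Matrix (Fin 2) (Fin 2) k) *ᵥ v) i) := by rw [ha]
    _ = ((((Matrix.GeneralLinearGroup.map f).comp ψ g : GL (Fin 2) k') :
          Matrix (Fin 2) (Fin 2) k') *ᵥ (⇑f ∘ v)) i := RingHom.map_mulVec f _ v i

end Small

/-! ## The stub -/

/-- **Stub 1 (`stub_blockModelFp`) — block-diagonal `𝔽_p`-descent of an `𝔽_p`-rational pair.**  `k`
algebraically closed of characteristic `p` (discrete); `σ, σ' : Γ_ℚ → GL₂(k)` continuous, irreducible, with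
`det σ = det σ' = ε̄⁻¹` (`DetCond`), EACH `𝔽_p`-rational (all characteristic polynomials from `𝔽_p[X]`).
Then there are `τ, τ' : Γ_ℚ → GL₂(𝔽_p)` and the block-diagonal `ρb = τ ⊕ τ' : Γ_ℚ → GL₄(𝔽_p)` (`IsBlockPair`)
with `ρb ⊗ k` conjugate to `σ ⊕ σ'` (LTWS `IsModelOf`), `τ`, `τ'` irreducible over `𝔽_p`, and
`det τ = det τ' = ε̄⁻¹` (`DetCondFp`).  Proof: Deligne–Serre 6.13 for `n = 2` twice (tree
`exists_descent_fin_two`) gives `ρ₁, ρ₂` over `𝔽_p` with the characteristic polynomials of `σ, σ'`,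
continuous by `ModelFp.continuous_of_ker_le`; `ρb = ρ₁ ⊕ ρ₂` (tree `exists_blockDiag_hom`); `ρb ⊗ k` is
conjugate to `σ ⊕ σ'` by Brauer–Nesbitt (`ModelFp.exists_conj_blockDiag`) — verbatim Case A
`ModelFp.exists_model_of_frobenius_fixed`; irreducibility over `𝔽_p` from that of `ρᵢ ⊗ k`
(`ModelFp.isIrreducible_of_charpoly_eq`, `isIrreducible_of_isIrreducible_map`); determinants read off the
constant coefficients (`map_det_of_charpoly_map_eq`) through the injection `𝔽_p → k`.
[cite: DeligneSerreASENS1974, Lemme 6.13] -/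
theorem stub_blockModelFp :
    ∀ (p : ℕ) [Fact p.Prime] (k : Type) [Field k] [CharP k p] [IsAlgClosed k]
      [TopologicalSpace k] [DiscreteTopology k] (σ σ' : FramedGaloisRep ℚ k 2),
      σ.toGaloisRep.IsIrreducible → σ'.toGaloisRep.IsIrreducible → DetCond p σ σ' →
      (∀ g : Field.absoluteGaloisGroup ℚ, ∃ Q₁ Q₂ : Polynomial (ZMod p),
        Q₁.map (ZMod.castHom (dvd_refl p) k) = FramedRep.charpoly σ g ∧
        Q₂.map (ZMod.castHom (dvd_refl p) k) = FramedRep.charpoly σ' g) →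
      ∃ (τ τ' : FramedGaloisRep ℚ (ZMod p) 2) (ρb : FramedGaloisRep ℚ (ZMod p) 4),
        IsBlockPair τ τ' ρb ∧ IsModelOf ρb σ σ' ∧
        τ.toGaloisRep.IsIrreducible ∧ τ'.toGaloisRep.IsIrreducible ∧ DetCondFp p τ τ' := by
  intro p _ k _ _ _ _ _ σ σ' hσ hσ' hdet hrat
  classical
  have hσi : σ.IsIrreducible := hσ
  have hσ'i : σ'.IsIrreducible := hσ'
  set c := ZMod.castHom (dvd_refl p) k with hcdef
  -- ### descent of each constituent to `GL₂(𝔽_p)` (Deligne–Serre 6.13, `n = 2`)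
  have hQ : ∀ g, ∃ Q : (ZMod p)[X], Q.map c =
      ((σ.toMonoidHom g : GL (Fin 2) k) : Matrix (Fin 2) (Fin 2) k).charpoly := fun g => by
    obtain ⟨Q₁, _, h₁, _⟩ := hrat g
    exact ⟨Q₁, h₁⟩
  have hQ' : ∀ g, ∃ Q : (ZMod p)[X], Q.map c =
      ((σ'.toMonoidHom g : GL (Fin 2) k) : Matrix (Fin 2) (Fin 2) k).charpoly := fun g => by
    obtain ⟨_, Q₂, _, h₂⟩ := hrat g
    exact ⟨Q₂, h₂⟩
  obtain ⟨ρ₁, hker₁, hchar₁⟩ := exists_descent_fin_two c σ.toMonoidHom hQ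
  obtain ⟨ρ₂, hker₂, hchar₂⟩ := exists_descent_fin_two c σ'.toMonoidHom hQ'
  -- ### continuity (open kernels): the framed `τ`, `τ'` and the block sum `ρb = τ ⊕ τ'`
  have hcont₁ : Continuous ρ₁ :=
    continuous_of_ker_le σ σ ρ₁ fun g hg _ => hker₁ (show σ.toMonoidHom g = 1 from hg)
  have hcont₂ : Continuous ρ₂ :=
    continuous_of_ker_le σ' σ' ρ₂ fun g hg _ => hker₂ (show σ'.toMonoidHom g = 1 from hg)
  let τ : FramedGaloisRep ℚ (ZMod p) 2 := ⟨ρ₁, hcont₁⟩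
  let τ' : FramedGaloisRep ℚ (ZMod p) 2 := ⟨ρ₂, hcont₂⟩
  obtain ⟨ρ₀, hρ₀⟩ :=
    exists_blockDiag_hom (k := ZMod p) (finSumFinEquiv : Fin 2 ⊕ Fin 2 ≃ Fin 4) ρ₁ ρ₂
  have hcont : Continuous ρ₀ := by
    refine continuous_of_ker_le σ σ' ρ₀ fun g hg hg' => ?_
    have h1 : ρ₁ g = 1 := hker₁ (show σ.toMonoidHom g = 1 from hg)
    have h2 : ρ₂ g = 1 := hker₂ (show σ'.toMonoidHom g = 1 from hg')
    refine Units.ext ?_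
    rw [hρ₀ g, h1, h2, Units.val_one, Units.val_one, Matrix.fromBlocks_one, Matrix.reindex_apply,
      Matrix.submatrix_one_equiv]
  let ρb : FramedGaloisRep ℚ (ZMod p) 4 := ⟨ρ₀, hcont⟩
  -- ### the base change `ρb ⊗ k = ψ₁ ⊕ ψ₂` is conjugate to `σ ⊕ σ'` (Brauer–Nesbitt)
  set ψ₁ : Field.absoluteGaloisGroup ℚ →* GL (Fin 2) k := (Matrix.GeneralLinearGroup.map c).comp ρ₁
    with hψ₁
  set ψ₂ : Field.absoluteGaloisGroup ℚ →* GL (Fin 2) k := (Matrix.GeneralLinearGroup.map c).comp ρ₂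
    with hψ₂
  set D : Field.absoluteGaloisGroup ℚ →* GL (Fin 4) k :=
    (FramedRep.baseChange c continuous_of_discreteTopology ρb).toMonoidHom with hDdef
  have hD : ∀ g, ((D g : GL (Fin 4) k) : Matrix (Fin 4) (Fin 4) k) =
      Matrix.reindex finSumFinEquiv finSumFinEquiv
        (Matrix.fromBlocks ((ψ₁ g : GL (Fin 2) k) : Matrix (Fin 2) (Fin 2) k) 0 0
          ((ψ₂ g : GL (Fin 2) k) : Matrix (Fin 2) (Fin 2) k)) := by
    intro g
    change (((ρ₀ g : GL (Fin 4) (ZMod p)) : Matrix (Fin 4) (Fin 4) (ZMod p))).map c = _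
    rw [hρ₀ g, map_reindex_fromBlocks_zero]
    rfl
  have h₁ : ∀ g, ((ψ₁ g : GL (Fin 2) k) : Matrix (Fin 2) (Fin 2) k).charpoly =
      ((σ.toMonoidHom g : GL (Fin 2) k) : Matrix (Fin 2) (Fin 2) k).charpoly := by
    intro g
    rw [← hchar₁ g, ← Matrix.charpoly_map]
    rfl
  have h₂ : ∀ g, ((ψ₂ g : GL (Fin 2) k) : Matrix (Fin 2) (Fin 2) k).charpoly =
      ((σ'.toMonoidHom g : GL (Fin 2) k) : Matrix (Fin 2) (Fin 2) k).charpoly := by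
    intro g
    rw [← hchar₂ g, ← Matrix.charpoly_map]
    rfl
  obtain ⟨Q, hQc⟩ := exists_conj_blockDiag σ.toMonoidHom σ'.toMonoidHom ψ₁ ψ₂ hσi hσ'i h₁ h₂ D hD
  -- ### irreducibility over `𝔽_p`
  have hirr₁ : τ.IsIrreducible :=
    isIrreducible_of_isIrreducible_map c ρ₁ (isIrreducible_of_charpoly_eq σ.toMonoidHom ψ₁ hσi h₁)
  have hirr₂ : τ'.IsIrreducible :=
    isIrreducible_of_isIrreducible_map c ρ₂ (isIrreducible_of_charpoly_eq σ'.toMonoidHom ψ₂ hσ'i h₂)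
  refine ⟨τ, τ', ρb, fun x => hρ₀ x, ⟨Q, fun g => hQc g⟩, hirr₁, hirr₂, fun g => ?_⟩
  -- ### determinants: `c (det ρᵢ(g)) = det σ(g) = c (ε̄(g)⁻¹)`, `c` injective
  obtain ⟨hd, hd'⟩ := hdet g
  have hv : Matrix.det ((σ g : GL (Fin 2) k) : Matrix (Fin 2) (Fin 2) k) =
      c (((epsBar p g)⁻¹ : (ZMod p)ˣ) : ZMod p) := by
    have := congrArg Units.val hd
    rwa [FramedRep.det_apply, Matrix.GeneralLinearGroup.val_det_apply, Units.coe_map_inv] at this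
  have hv' : Matrix.det ((σ' g : GL (Fin 2) k) : Matrix (Fin 2) (Fin 2) k) =
      c (((epsBar p g)⁻¹ : (ZMod p)ˣ) : ZMod p) := by
    have := congrArg Units.val hd'
    rw [FramedRep.det_apply, FramedRep.det_apply, Matrix.GeneralLinearGroup.val_det_apply,
      Matrix.GeneralLinearGroup.val_det_apply] at this
    rw [this, hv]
  have e₁ := map_det_of_charpoly_map_eq c _ _ (hchar₁ g)
  have e₂ := map_det_of_charpoly_map_eq c _ _ (hchar₂ g)
  constructor
  · apply Units.ext
    apply c.injective
    rw [FramedRep.det_apply, Matrix.GeneralLinearGroup.val_det_apply]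
    exact e₁.trans hv
  · apply Units.ext
    apply c.injective
    rw [FramedRep.det_apply, Matrix.GeneralLinearGroup.val_det_apply]
    exact e₂.trans hv'

end Summit.Langlands.Langlands.Cruxes.StableYoshidaCongruence.BilevelOneFiveAnchor

end
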